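import Literature.Probability.RandomPlanarGeometry.HexSAWLattice
import Literature.Probability.RandomPlanarGeometry.HexParafermion
import Literature.Probability.RandomPlanarGeometry.HexParafermionTransport
import Mathlib.Analysis.Real.Pi.Bounds

/-!
# `NoFoldBound` negative lemmas (crux stmt-CriticalPhenomena-8296), holed witness I: the 12-ring and its self-avoiding lists

Part 1 of 4 of the exact evaluation of the Duminil-Copin–Smirnov parafermionic observable
(`hexParafermionicObservable`, `x = x_c`, `σ = 5/8`) on the NON-simply-connected domain
`Λ₁₂` = the 12-cycle of the hexagonal lattice around the missing vertex `(![-1,1],1)`, source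
`a = {(![0,-1],1) ∉ Λ₁₂, (![0,0],0)}` on the outer boundary, which shows that the simple-connectivity
hypothesis of `NoFoldBound` (route SAWDevelopingMap) is load-bearing: at the antipodal vertex the
Beltrami mode exceeds the sum mode by the factor `cot 15° · β_T/α_T = 2.2915…`
(`Ring12Refutation.lean`). This file: the two traversals `ringD1`, `ringD2`, the domain `Λ₁₂`, the
explicit neighbour lemmas `adj_up_iff` / `adj_down_iff`, and **`ring_classify`**: every
self-avoiding `hexGraph`-chain of `Λ₁₂` from the source vertex is a prefix of one of the two
traversals (forced steps; 24 × 3 cases closed by `decide`).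
-/

open Literature.Probability.LatticeModels Literature.Probability.RandomPlanarGeometry.SAW
open Literature.Probability.RandomPlanarGeometry.SAW.HV (omg omg_sq omg_add_one_ne_zero triZeta_eq_omg omg_pow_three
  two_mul_xc_mul_cos)

namespace Summit.CriticalPhenomena.SAWScalingLimit.Theorems.NoFoldBound.Negative

/-! ### The holed witness: the 12-cycle of `ℍ` around the missing vertex `(![-1,1],1)` -/

/-- The 12-ring traversed in direction 1 from the source vertex `(![0,0],0)`. [folklore] -/
def ringD1 : List HexVertex := [(![0, 0], 0), (![0, 0], 1), (![0, 1], 0), (![0, 1], 1), (![0, 2], 0), (![-1, 2], 1), (![-1, 2], 0), (![-2, 2], 1), (![-2, 2], 0), (![-2, 1], 1), (![-1, 1], 0), (![-1, 0], 1)]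
/-- The 12-ring traversed in direction 2. [folklore] -/
def ringD2 : List HexVertex := [(![0, 0], 0), (![-1, 0], 1), (![-1, 1], 0), (![-2, 1], 1), (![-2, 2], 0), (![-2, 2], 1), (![-1, 2], 0), (![-1, 2], 1), (![0, 2], 0), (![0, 1], 1), (![0, 1], 0), (![0, 0], 1)]
/-- The holed domain `Λ₁₂` (its complement `{(![-1,1],1)} ∪ outside` is disconnected). [folklore] -/
def Λ₁₂ : Finset HexVertex := {(![0, 0], 0), (![0, 0], 1), (![0, 1], 0), (![0, 1], 1), (![0, 2], 0), (![-1, 2], 1), (![-1, 2], 0), (![-2, 2], 1), (![-2, 2], 0), (![-2, 1], 1), (![-1, 1], 0), (![-1, 0], 1)}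
/-- The self-avoiding vertex lists of `Λ₁₂` from the source vertex: prefixes of the two traversals. [folklore] -/
def ringPrefixes : List (List HexVertex) :=
  (List.range 12).map (fun k => ringD1.take (k + 1)) ++ (List.range 12).map (fun k => ringD2.take (k + 1))

/-- The three neighbours of a face of the hexagonal lattice, explicitly. [folklore] -/
theorem adj_up_iff (a b : ℤ) (y : HexVertex) : hexGraph.Adj (![a, b], 0) y ↔
    y = (![a, b], 1) ∨ y = (![a - 1, b], 1) ∨ y = (![a, b - 1], 1) := by
  obtain ⟨x, t⟩ := y
  rw [hexGraph_adj_iff_coord]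
  simp only [Prod.ext_iff, site_two_eq_iff, Matrix.cons_val_zero, Matrix.cons_val_one]
  fin_cases t <;> simp

/-- The three neighbours of a face of the hexagonal lattice, explicitly. [folklore] -/
theorem adj_down_iff (a b : ℤ) (y : HexVertex) : hexGraph.Adj (![a, b], 1) y ↔
    y = (![a, b], 0) ∨ y = (![a + 1, b], 0) ∨ y = (![a, b + 1], 0) := by
  obtain ⟨x, t⟩ := y
  rw [hexGraph_adj_iff_coord]
  simp only [Prod.ext_iff, site_two_eq_iff, Matrix.cons_val_zero, Matrix.cons_val_one]
  fin_cases t <;> simp; omega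

/-- **Classification of the self-avoiding vertex lists of the ring from the source vertex.**
[folklore] -/
theorem ring_classify : ∀ (n : ℕ) (l : List HexVertex), l.length = n + 1 →
    l.IsChain hexGraph.Adj → (∀ x ∈ l, x ∈ Λ₁₂) → l.Nodup → l.head? = some (![0, 0], 0) →
    l ∈ ringPrefixes := by
  intro n
  induction n with
  | zero =>
    intro l hl hc hs hn hh
    match l, hl with
    | [x], _ =>
      simp only [List.head?_cons, Option.some.injEq] at hh
      subst hh; decide
  | succ n ih =>
    intro l hl hc hs hn hh
    have hne : l ≠ [] := by rintro rfl; simp at hl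
    set l' := l.dropLast with hl'def
    set y := l.getLast hne with hydef
    have hsplit : l = l' ++ [y] := (List.dropLast_append_getLast hne).symm
    have hlen' : l'.length = n + 1 := by rw [hl'def, List.length_dropLast, hl]; rfl
    have hne' : l' ≠ [] := by rintro h; rw [h] at hlen'; simp at hlen'
    rw [hsplit] at hc hs hn hh
    have hc' : l'.IsChain hexGraph.Adj := (List.isChain_append.1 hc).1
    have hs' : ∀ x ∈ l', x ∈ Λ₁₂ := fun x hx => hs x (List.mem_append_left _ hx)
    have hn' : l'.Nodup := hn.of_append_left
    have hh' : l'.head? = some (![0, 0], 0) := by rwa [List.head?_append_of_ne_nil _ hne'] at hh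
    have hadj : hexGraph.Adj (l'.getLast hne') y :=
      (List.isChain_append.1 hc).2.2 _ (by rw [Option.mem_def, List.getLast?_eq_some_getLast]) _ (by simp)
    have hmem := ih l' hlen' hc' hs' hn' hh'
    rw [hsplit]
    clear_value l' y
    clear hsplit hc hh hc' hs' hn' hh' hl hlen' hl'def hydef
    simp only [ringPrefixes, List.mem_append, List.mem_map, List.mem_range] at hmem
    obtain ⟨k, hk, rfl⟩ | ⟨k, hk, rfl⟩ := hmem
    · interval_cases k
      · -- ringD1, k = 0, last vertex (0, 0, 0)
        have e : (List.take (0 + 1) ringD1).getLast hne' = (![0, 0], 0) := by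
          rfl
        rw [e, adj_up_iff] at hadj
        rcases hadj with rfl | rfl | rfl
        · decide
        · decide
        · exact absurd (hs (![0, -1], 1) (by simp)) (by decide)
      · -- ringD1, k = 1, last vertex (0, 0, 1)
        have e : (List.take (1 + 1) ringD1).getLast hne' = (![0, 0], 1) := by
          rfl
        rw [e, adj_down_iff] at hadj
        rcases hadj with rfl | rfl | rfl
        · exact absurd hn (by decide)
        · exact absurd (hs (![1, 0], 0) (by simp)) (by decide)
        · decide
      · -- ringD1, k = 2, last vertex (0, 1, 0)
        have e : (List.take (2 + 1) ringD1).getLast hne' = (![0, 1], 0) := by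
          rfl
        rw [e, adj_up_iff] at hadj
        rcases hadj with rfl | rfl | rfl
        · decide
        · exact absurd (hs (![-1, 1], 1) (by simp)) (by decide)
        · exact absurd hn (by decide)
      · -- ringD1, k = 3, last vertex (0, 1, 1)
        have e : (List.take (3 + 1) ringD1).getLast hne' = (![0, 1], 1) := by
          rfl
        rw [e, adj_down_iff] at hadj
        rcases hadj with rfl | rfl | rfl
        · exact absurd hn (by decide)
        · exact absurd (hs (![1, 1], 0) (by simp)) (by decide)
        · decide
      · -- ringD1, k = 4, last vertex (0, 2, 0)
        have e : (List.take (4 + 1) ringD1).getLast hne' = (![0, 2], 0) := by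
          rfl
        rw [e, adj_up_iff] at hadj
        rcases hadj with rfl | rfl | rfl
        · exact absurd (hs (![0, 2], 1) (by simp)) (by decide)
        · decide
        · exact absurd hn (by decide)
      · -- ringD1, k = 5, last vertex (-1, 2, 1)
        have e : (List.take (5 + 1) ringD1).getLast hne' = (![-1, 2], 1) := by
          rfl
        rw [e, adj_down_iff] at hadj
        rcases hadj with rfl | rfl | rfl
        · decide
        · exact absurd hn (by decide)
        · exact absurd (hs (![-1, 3], 0) (by simp)) (by decide)
      · -- ringD1, k = 6, last vertex (-1, 2, 0)
        have e : (List.take (6 + 1) ringD1).getLast hne' = (![-1, 2], 0) := by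
          rfl
        rw [e, adj_up_iff] at hadj
        rcases hadj with rfl | rfl | rfl
        · exact absurd hn (by decide)
        · decide
        · exact absurd (hs (![-1, 1], 1) (by simp)) (by decide)
      · -- ringD1, k = 7, last vertex (-2, 2, 1)
        have e : (List.take (7 + 1) ringD1).getLast hne' = (![-2, 2], 1) := by
          rfl
        rw [e, adj_down_iff] at hadj
        rcases hadj with rfl | rfl | rfl
        · decide
        · exact absurd hn (by decide)
        · exact absurd (hs (![-2, 3], 0) (by simp)) (by decide)
      · -- ringD1, k = 8, last vertex (-2, 2, 0)
        have e : (List.take (8 + 1) ringD1).getLast hne' = (![-2, 2], 0) := by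
          rfl
        rw [e, adj_up_iff] at hadj
        rcases hadj with rfl | rfl | rfl
        · exact absurd hn (by decide)
        · exact absurd (hs (![-3, 2], 1) (by simp)) (by decide)
        · decide
      · -- ringD1, k = 9, last vertex (-2, 1, 1)
        have e : (List.take (9 + 1) ringD1).getLast hne' = (![-2, 1], 1) := by
          rfl
        rw [e, adj_down_iff] at hadj
        rcases hadj with rfl | rfl | rfl
        · exact absurd (hs (![-2, 1], 0) (by simp)) (by decide)
        · decide
        · exact absurd hn (by decide)
      · -- ringD1, k = 10, last vertex (-1, 1, 0)
        have e : (List.take (10 + 1) ringD1).getLast hne' = (![-1, 1], 0) := by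
          rfl
        rw [e, adj_up_iff] at hadj
        rcases hadj with rfl | rfl | rfl
        · exact absurd (hs (![-1, 1], 1) (by simp)) (by decide)
        · exact absurd hn (by decide)
        · decide
      · -- ringD1, k = 11, last vertex (-1, 0, 1)
        have e : (List.take (11 + 1) ringD1).getLast hne' = (![-1, 0], 1) := by
          rfl
        rw [e, adj_down_iff] at hadj
        rcases hadj with rfl | rfl | rfl
        · exact absurd (hs (![-1, 0], 0) (by simp)) (by decide)
        · exact absurd hn (by decide)
        · exact absurd hn (by decide)
    · interval_cases k
      · -- ringD2, k = 0, last vertex (0, 0, 0)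
        have e : (List.take (0 + 1) ringD2).getLast hne' = (![0, 0], 0) := by
          rfl
        rw [e, adj_up_iff] at hadj
        rcases hadj with rfl | rfl | rfl
        · decide
        · decide
        · exact absurd (hs (![0, -1], 1) (by simp)) (by decide)
      · -- ringD2, k = 1, last vertex (-1, 0, 1)
        have e : (List.take (1 + 1) ringD2).getLast hne' = (![-1, 0], 1) := by
          rfl
        rw [e, adj_down_iff] at hadj
        rcases hadj with rfl | rfl | rfl
        · exact absurd (hs (![-1, 0], 0) (by simp)) (by decide)
        · exact absurd hn (by decide)
        · decide
      · -- ringD2, k = 2, last vertex (-1, 1, 0)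
        have e : (List.take (2 + 1) ringD2).getLast hne' = (![-1, 1], 0) := by
          rfl
        rw [e, adj_up_iff] at hadj
        rcases hadj with rfl | rfl | rfl
        · exact absurd (hs (![-1, 1], 1) (by simp)) (by decide)
        · decide
        · exact absurd hn (by decide)
      · -- ringD2, k = 3, last vertex (-2, 1, 1)
        have e : (List.take (3 + 1) ringD2).getLast hne' = (![-2, 1], 1) := by
          rfl
        rw [e, adj_down_iff] at hadj
        rcases hadj with rfl | rfl | rfl
        · exact absurd (hs (![-2, 1], 0) (by simp)) (by decide)
        · exact absurd hn (by decide)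
        · decide
      · -- ringD2, k = 4, last vertex (-2, 2, 0)
        have e : (List.take (4 + 1) ringD2).getLast hne' = (![-2, 2], 0) := by
          rfl
        rw [e, adj_up_iff] at hadj
        rcases hadj with rfl | rfl | rfl
        · decide
        · exact absurd (hs (![-3, 2], 1) (by simp)) (by decide)
        · exact absurd hn (by decide)
      · -- ringD2, k = 5, last vertex (-2, 2, 1)
        have e : (List.take (5 + 1) ringD2).getLast hne' = (![-2, 2], 1) := by
          rfl
        rw [e, adj_down_iff] at hadj
        rcases hadj with rfl | rfl | rfl
        · exact absurd hn (by decide)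
        · decide
        · exact absurd (hs (![-2, 3], 0) (by simp)) (by decide)
      · -- ringD2, k = 6, last vertex (-1, 2, 0)
        have e : (List.take (6 + 1) ringD2).getLast hne' = (![-1, 2], 0) := by
          rfl
        rw [e, adj_up_iff] at hadj
        rcases hadj with rfl | rfl | rfl
        · decide
        · exact absurd hn (by decide)
        · exact absurd (hs (![-1, 1], 1) (by simp)) (by decide)
      · -- ringD2, k = 7, last vertex (-1, 2, 1)
        have e : (List.take (7 + 1) ringD2).getLast hne' = (![-1, 2], 1) := by
          rfl
        rw [e, adj_down_iff] at hadj
        rcases hadj with rfl | rfl | rfl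
        · exact absurd hn (by decide)
        · decide
        · exact absurd (hs (![-1, 3], 0) (by simp)) (by decide)
      · -- ringD2, k = 8, last vertex (0, 2, 0)
        have e : (List.take (8 + 1) ringD2).getLast hne' = (![0, 2], 0) := by
          rfl
        rw [e, adj_up_iff] at hadj
        rcases hadj with rfl | rfl | rfl
        · exact absurd (hs (![0, 2], 1) (by simp)) (by decide)
        · exact absurd hn (by decide)
        · decide
      · -- ringD2, k = 9, last vertex (0, 1, 1)
        have e : (List.take (9 + 1) ringD2).getLast hne' = (![0, 1], 1) := by
          rfl
        rw [e, adj_down_iff] at hadj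
        rcases hadj with rfl | rfl | rfl
        · decide
        · exact absurd (hs (![1, 1], 0) (by simp)) (by decide)
        · exact absurd hn (by decide)
      · -- ringD2, k = 10, last vertex (0, 1, 0)
        have e : (List.take (10 + 1) ringD2).getLast hne' = (![0, 1], 0) := by
          rfl
        rw [e, adj_up_iff] at hadj
        rcases hadj with rfl | rfl | rfl
        · exact absurd hn (by decide)
        · exact absurd (hs (![-1, 1], 1) (by simp)) (by decide)
        · decide
      · -- ringD2, k = 11, last vertex (0, 0, 1)
        have e : (List.take (11 + 1) ringD2).getLast hne' = (![0, 0], 1) := by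
          rfl
        rw [e, adj_down_iff] at hadj
        rcases hadj with rfl | rfl | rfl
        · exact absurd hn (by decide)
        · exact absurd (hs (![1, 0], 0) (by simp)) (by decide)
        · exact absurd hn (by decide)

end Summit.CriticalPhenomena.SAWScalingLimit.Theorems.NoFoldBound.Negative
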